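import Summits.Ventures.PercRepro.S2FlatPairs
import Summits.Ventures.PercRepro.S2FlatCase
import Summits.Ventures.PercRepro.S2DichotomyTools
import Summits.Ventures.PercRepro.S2CoindepNullity

/-!
# PercRepro — S2: THE FLAT COUNT AT `d − k = 2`, SHARPENED AT `m = 5` (p7, gen 13; sub-claim S2; the cells `(14, 8)`, `(14, 10)`)

S2FlatCountTwo's `topCount_le_flat_count_two` word for word, with the class «`i = 2`, `ρ(B ∩ W) = 4`» dropped at `m = 5`: a `3`-point
`B ∩ W` has rank `≤ 3`, so the term `C(w, 3)·(n − w)·(d − 1)/2` of the kit's count is spurious — `14,157` of the `375,089` at `(14, 10)`,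
`ν = 8`, and `6,353` of the `92,986` at `(14, 8)`, `ν = 6`, exactly the margins those two cases were missing (`1.009` each).
**`topCount_le_flat_count_two_sharp`**. Axioms: standard.
-/

open scoped Matroid

namespace PercRepro

namespace ThmN

open Set

variable {α : Type}

/-- **The flat count at `d − k = 2`**: on the `e`-free core of rank `p`, corank `d ≥ 6`, with `W ⊆ E` of nullity `d − 2` on `w ≤ 3 + d`
points and no set of nullity `d − 1` on `≤ 4 + d` points,
`#U(p, 5) ≤ Σ_{m=5}^{d} ( C(w, m) + C(w, m − 1)·(n − w) + C(w, m − 2)·(n − w)·(3 + d − (m − 2) − 1)/2 + N₃(m − 2)·C(n − w, 2) )`,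
`N₃(3) = C(w, 3)`, `N₃(j) = C(w, 3)·C(3, j − 3)/(j − 2)` for `j ≥ 4`. -/
theorem topCount_le_flat_count_two_sharp (M : Matroid α) [M.Finite] (p d : ℕ) (hd6 : 6 ≤ d)
    (hR : M.eRank = (p : ℕ∞)) (hn : M.E.ncard = p + d)
    (hfree : ∀ e ∈ M.E, ∃ A ⊆ M.E \ {e}, e ∉ M.closure A ∧ e ∉ M.closure ((M.E \ {e}) \ A))
    {W : Set α} (hW : W ⊆ M.E) (hWk : W.encard = M.eRk W + ((d - 2 : ℕ) : ℕ∞)) (hw : W.ncard ≤ 3 + d)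
    (hns : ¬ ∃ W' ⊆ M.E, W'.ncard ≤ 4 + d ∧ W'.encard = M.eRk W' + ((d - 1 : ℕ) : ℕ∞)) :
    (Matroid.topCount M p 5 : ℚ) ≤ ∑ m ∈ Finset.Icc 5 d,
      ((W.ncard.choose m : ℚ) + (W.ncard.choose (m - 1) : ℚ) * ((p + d - W.ncard : ℕ) : ℚ) +
        (if m ≤ 5 then 0 else (W.ncard.choose (m - 2) : ℚ)) * ((p + d - W.ncard : ℕ) : ℚ) * ((3 + d - (m - 2) - 1 : ℕ) : ℚ) / 2 +
        (if m ≤ 5 then (W.ncard.choose 3 : ℚ)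
          else (W.ncard.choose 3 : ℚ) * (Nat.choose 3 (m - 5) : ℚ) / ((m - 4 : ℕ) : ℚ)) *
          ((p + d - W.ncard).choose 2 : ℚ)) := by
  classical
  have hd : M.E.encard = M.eRank + d := by
    rw [hR, ← M.ground_finite.cast_ncard_eq, hn]
    push_cast
    ring
  have hL : ∀ e ∈ M.E, ¬ M.IsLoop e := not_isLoop_of_free M hfree
  have hplane : ∀ P ⊆ M.E, M.eRk P ≤ 3 → P.ncard ≤ 6 := fun P hP hr =>
    ncard_le_six_of_eRk_le_three_of_free M hfree hP hr
  have hWfin : W.Finite := M.ground_finite.subset hW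
  have hns' : ¬ ∃ W' ⊆ M.E, W'.ncard ≤ 6 + (d - 2) ∧ W'.encard = M.eRk W' + ((d - 2 : ℕ) + 1) := by
    intro ⟨W', hW'E, hW'n, hW'k⟩
    refine hns ⟨W', hW'E, by omega, ?_⟩
    rw [hW'k]
    congr 1
    exact_mod_cast (show d - 2 + 1 = d - 1 by omega)
  have hWcl : M.closure W = W :=
    S2.closure_eq_self_of_not_nullity_succ M (d - 2) hW hWk (by omega) hns'
  have hf : ∀ F ⊆ M.E, M.eRk F ≤ 5 → F.ncard ≤ 3 + d := by
    intro F hF hr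
    have hns'' : ¬ ∃ W' ⊆ M.E, W'.ncard ≤ 4 + d ∧ W'.encard = M.eRk W' + (d - 1 : ℕ) := hns
    have := S2.ncard_le_of_eRk_le_of_not_nullity M (d - 1) (4 + d) (by omega) hns'' hF (r := 5) le_rfl hr
    omega
  have hRne : M.eRank ≠ ⊤ := (Matroid.eRank_ne_top_iff M).2 inferInstance
  have hWrk : M.eRk W ≠ ⊤ := ne_top_of_le_ne_top hWfin.encard_lt_top.ne (M.eRk_le_encard W)
  have hEWcard : (M.E \ W).ncard = p + d - W.ncard := by
    rw [Set.ncard_sdiff hW hWfin, hn]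
  -- step 1: the top count, size by size, with the rank kept
  have hstep1 : Matroid.topCount M p 5 ≤ ∑ m ∈ Finset.Icc 5 d,
      {B : Set α | B ⊆ M.E ∧ B.ncard = m ∧ M.eRk B = 5 ∧ M.eRk (M.E \ B) = M.eRank}.ncard := by
    refine (S2.topCount_le_ncard_compl_spanning (M := M) hR hd 5).trans ?_
    refine le_trans (Set.ncard_le_ncard ?_ ?_) (Finset.set_ncard_biUnion_le (Finset.Icc 5 d)
      (fun m => {B : Set α | B ⊆ M.E ∧ B.ncard = m ∧ M.eRk B = 5 ∧ M.eRk (M.E \ B) = M.eRank}))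
    · intro B hB
      obtain ⟨hBE, hBr, hBd, hBs⟩ := hB
      have hBfin : B.Finite := M.ground_finite.subset hBE
      have hq : 5 ≤ B.ncard := by
        have h := M.eRk_le_encard B
        rw [hBr, ← hBfin.cast_ncard_eq] at h
        exact_mod_cast h
      exact Set.mem_iUnion₂.2 ⟨B.ncard, Finset.mem_Icc.2 ⟨hq, hBd⟩, hBE, rfl, hBr, hBs⟩
    · exact M.ground_finite.finite_subsets.subset (fun B hB => by
        obtain ⟨m, -, hB⟩ := Set.mem_iUnion₂.1 hB
        exact hB.1)
  -- step 2: each size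
  have hstep2 : ∀ m ∈ Finset.Icc 5 d,
      ({B : Set α | B ⊆ M.E ∧ B.ncard = m ∧ M.eRk B = 5 ∧ M.eRk (M.E \ B) = M.eRank}.ncard : ℚ) ≤
      ((W.ncard.choose m : ℚ) + (W.ncard.choose (m - 1) : ℚ) * ((p + d - W.ncard : ℕ) : ℚ) +
        (if m ≤ 5 then 0 else (W.ncard.choose (m - 2) : ℚ)) * ((p + d - W.ncard : ℕ) : ℚ) * ((3 + d - (m - 2) - 1 : ℕ) : ℚ) / 2 +
        (if m ≤ 5 then (W.ncard.choose 3 : ℚ)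
          else (W.ncard.choose 3 : ℚ) * (Nat.choose 3 (m - 5) : ℚ) / ((m - 4 : ℕ) : ℚ)) *
          ((p + d - W.ncard).choose 2 : ℚ)) := by
    intro m hm
    rw [Finset.mem_Icc] at hm
    obtain ⟨hm5, hmd⟩ := hm
    -- the four classes
    set A4 : ℕ → Set (Set α) := fun j => {X : Set α | X ⊆ W ∧ X.ncard = j ∧ M.eRk X = 4} with hA4
    set A3 : ℕ → Set (Set α) := fun j => {X : Set α | X ⊆ W ∧ X.ncard = j ∧ M.eRk X = 3} with hA3
    set C0 : Set (Set α) := {B : Set α | B ⊆ W ∧ B.ncard = m} with hC0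
    set C1 : Set (Set α) := {B : Set α | B ⊆ M.E ∧ B ∩ W ∈ A4 (m - 1) ∧ (B \ W).ncard = 1 ∧ M.eRk B = 5} with hC1
    set C2 : Set (Set α) := {B : Set α | B ⊆ M.E ∧ B ∩ W ∈ A4 (m - 2) ∧ (B \ W).ncard = 2 ∧ M.eRk B = 5} with hC2
    set C3 : Set (Set α) := {B : Set α | B ⊆ M.E ∧ B ∩ W ∈ A3 (m - 2) ∧ (B \ W).ncard = 2} with hC3
    have hfinE : ∀ S : Set (Set α), (∀ B ∈ S, B ⊆ M.E) → S.Finite := fun S hS =>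
      M.ground_finite.finite_subsets.subset hS
    have hC0fin : C0.Finite := hfinE _ (fun B hB => hB.1.trans hW)
    have hC1fin : C1.Finite := hfinE _ (fun B hB => hB.1)
    have hC2fin : C2.Finite := hfinE _ (fun B hB => hB.1)
    have hC3fin : C3.Finite := hfinE _ (fun B hB => hB.1)
    -- the cover
    have hcover : {B : Set α | B ⊆ M.E ∧ B.ncard = m ∧ M.eRk B = 5 ∧ M.eRk (M.E \ B) = M.eRank} ⊆
        C0 ∪ C1 ∪ C2 ∪ C3 := by
      intro B hB
      obtain ⟨hBE, hBm, hB5, hBs⟩ := hB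
      have hBfin : B.Finite := M.ground_finite.subset hBE
      -- the hitting bound: `|B ∖ W| ≤ 2`
      have hhit := S2.encard_add_le_of_spanning_compl_of_nullity M hBE hW hBs hd hWk hWrk hRne
      have hWBfin : (W ∩ B).Finite := hWfin.subset Set.inter_subset_left
      rw [← hBfin.cast_ncard_eq, ← hWBfin.cast_ncard_eq] at hhit
      have hhit' : B.ncard + (d - 2) ≤ d + (W ∩ B).ncard := by exact_mod_cast hhit
      have hsplit := Set.ncard_inter_add_ncard_sdiff_eq_ncard B W hBfin
      rw [Set.inter_comm] at hhit'
      have hi2 : (B \ W).ncard ≤ 2 := by omega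
      have hj : (B ∩ W).ncard = m - (B \ W).ncard := by omega
      by_cases hi0 : (B \ W).ncard = 0
      · -- `B ⊆ W`
        have hBW : B \ W = ∅ := (Set.ncard_eq_zero (hBfin.subset Set.sdiff_subset)).1 hi0
        have hBsub : B ⊆ W := Set.sdiff_eq_empty.1 hBW
        exact Or.inl (Or.inl (Or.inl ⟨hBsub, hBm⟩))
      · have hne : (B \ W).Nonempty := Set.nonempty_of_ncard_ne_zero hi0
        have hr4 : M.eRk (B ∩ W) ≤ 4 := S2.eRk_inter_le_four_of_diff_nonempty M hWcl hBE hB5 hne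
        -- the lower bound `5 ≤ ρ(B ∩ W) + |B ∖ W|`
        have hlow : (5 : ℕ∞) ≤ M.eRk (B ∩ W) + ((B \ W).ncard : ℕ∞) := by
          have h1 : M.eRk B ≤ M.eRk (B ∩ W) + M.eRk (B \ W) := by
            have := M.eRk_union_le_eRk_add_eRk (B ∩ W) (B \ W)
            rwa [Set.inter_union_sdiff] at this
          have h2 : M.eRk (B \ W) ≤ ((B \ W).ncard : ℕ∞) := by
            rw [(hBfin.subset Set.sdiff_subset).cast_ncard_eq]
            exact M.eRk_le_encard _
          rw [← hB5]
          exact h1.trans (add_le_add le_rfl h2)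
        have hrne : M.eRk (B ∩ W) ≠ ⊤ := ne_top_of_le_ne_top (by decide : (4 : ℕ∞) ≠ ⊤) hr4
        obtain ⟨t, ht⟩ : ∃ t : ℕ, M.eRk (B ∩ W) = t := ⟨(M.eRk (B ∩ W)).toNat, (ENat.coe_toNat hrne).symm⟩
        rw [ht] at hr4 hlow
        have hr4' : t ≤ 4 := by exact_mod_cast hr4
        have hlow' : 5 ≤ t + (B \ W).ncard := by exact_mod_cast hlow
        have hBWsub : B ∩ W ⊆ W := Set.inter_subset_right
        rcases Nat.lt_or_ge (B \ W).ncard 2 with hi1 | hi2'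
        · -- `i = 1`, `ρ(B ∩ W) = 4`
          have hi : (B \ W).ncard = 1 := by omega
          have ht4 : t = 4 := by omega
          refine Or.inl (Or.inl (Or.inr ⟨hBE, ⟨hBWsub, by omega, by rw [ht, ht4]; rfl⟩, hi, hB5⟩))
        · have hi : (B \ W).ncard = 2 := by omega
          rcases Nat.lt_or_ge t 4 with ht3 | ht4
          · have ht3' : t = 3 := by omega
            exact Or.inr ⟨hBE, ⟨hBWsub, by omega, by rw [ht, ht3']; rfl⟩, hi⟩
          · have ht4' : t = 4 := by omega
            exact Or.inl (Or.inr ⟨hBE, ⟨hBWsub, by omega, by rw [ht, ht4']; rfl⟩, hi, hB5⟩)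
    have hunion : {B : Set α | B ⊆ M.E ∧ B.ncard = m ∧ M.eRk B = 5 ∧ M.eRk (M.E \ B) = M.eRank}.ncard ≤
        C0.ncard + C1.ncard + C2.ncard + C3.ncard := by
      calc {B : Set α | B ⊆ M.E ∧ B.ncard = m ∧ M.eRk B = 5 ∧ M.eRk (M.E \ B) = M.eRank}.ncard
          ≤ (C0 ∪ C1 ∪ C2 ∪ C3).ncard :=
            Set.ncard_le_ncard hcover (((hC0fin.union hC1fin).union hC2fin).union hC3fin)
        _ ≤ (C0 ∪ C1 ∪ C2).ncard + C3.ncard := Set.ncard_union_le _ _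
        _ ≤ (C0 ∪ C1).ncard + C2.ncard + C3.ncard := by
            have := Set.ncard_union_le (C0 ∪ C1) C2
            omega
        _ ≤ C0.ncard + C1.ncard + C2.ncard + C3.ncard := by
            have := Set.ncard_union_le C0 C1
            omega
    -- the four bounds
    have hb0 : C0.ncard = W.ncard.choose m := S2.ncard_subsets_ncard_eq W hWfin m
    have hA4le : ∀ j, (A4 j).ncard ≤ W.ncard.choose j := fun j => by
      rw [← S2.ncard_subsets_ncard_eq W hWfin j]
      exact Set.ncard_le_ncard (fun X hX => ⟨hX.1, hX.2.1⟩) (hWfin.finite_subsets.subset (fun X hX => hX.1))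
    have hb1 : C1.ncard ≤ W.ncard.choose (m - 1) * (p + d - W.ncard) := by
      have h := S2.ncard_class_four_mul_le M hW hWcl (3 + d) hf (A4 (m - 1)) (m - 1) (fun X hX => hX) 1 le_rfl
      rw [mul_one, Nat.choose_zero_right, mul_one, hEWcard] at h
      exact h.trans (Nat.mul_le_mul_right _ (hA4le (m - 1)))
    have hA4sharp : (A4 (m - 2)).ncard ≤ if m ≤ 5 then 0 else W.ncard.choose (m - 2) := by
      by_cases hm5 : m ≤ 5
      · rw [if_pos hm5]
        have hm5' : m = 5 := by omega
        have hempty : A4 (m - 2) = ∅ := by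
          rw [Set.eq_empty_iff_forall_notMem]
          intro X hX
          obtain ⟨hXW, hXc, hXr⟩ := hX
          have hXfin : X.Finite := hWfin.subset hXW
          have h := M.eRk_le_encard X
          rw [hXr, ← hXfin.cast_ncard_eq, hXc, hm5'] at h
          norm_num at h
        rw [hempty, Set.ncard_empty]
      · rw [if_neg hm5]
        exact hA4le (m - 2)
    have hb2 : C2.ncard * 2 ≤ (if m ≤ 5 then 0 else W.ncard.choose (m - 2)) * ((p + d - W.ncard) * (3 + d - (m - 2) - 1)) := by
      have h := S2.ncard_class_four_mul_le M hW hWcl (3 + d) hf (A4 (m - 2)) (m - 2) (fun X hX => hX) 2 (by norm_num)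
      rw [show (2 : ℕ) - 1 = 1 from rfl, Nat.choose_one_right, hEWcard] at h
      exact h.trans (Nat.mul_le_mul_right _ hA4sharp)
    have hb3 : C3.ncard ≤ (A3 (m - 2)).ncard * (p + d - W.ncard).choose 2 := by
      have h := S2.ncard_split_le M hW (A3 (m - 2)) (fun X hX => hX.1) 2
      rwa [hEWcard] at h
    -- assemble in `ℚ`
    have hEWq : (0 : ℚ) ≤ ((p + d - W.ncard : ℕ) : ℚ) := by positivity
    have hq0 : (C0.ncard : ℚ) = (W.ncard.choose m : ℚ) := by exact_mod_cast hb0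
    have hq1 : (C1.ncard : ℚ) ≤ (W.ncard.choose (m - 1) : ℚ) * ((p + d - W.ncard : ℕ) : ℚ) := by exact_mod_cast hb1
    have hq2 : (C2.ncard : ℚ) ≤
        (if m ≤ 5 then 0 else (W.ncard.choose (m - 2) : ℚ)) * ((p + d - W.ncard : ℕ) : ℚ) * ((3 + d - (m - 2) - 1 : ℕ) : ℚ) / 2 := by
      have h : ((C2.ncard * 2 : ℕ) : ℚ) ≤
          (((if m ≤ 5 then 0 else W.ncard.choose (m - 2)) * ((p + d - W.ncard) * (3 + d - (m - 2) - 1)) : ℕ) : ℚ) := by exact_mod_cast hb2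
      push_cast at h
      split_ifs at h ⊢ <;> linarith
    have hq3 : (C3.ncard : ℚ) ≤
        (if m ≤ 5 then (W.ncard.choose 3 : ℚ)
          else (W.ncard.choose 3 : ℚ) * (Nat.choose 3 (m - 5) : ℚ) / ((m - 4 : ℕ) : ℚ)) *
          ((p + d - W.ncard).choose 2 : ℚ) := by
      have h3 : (C3.ncard : ℚ) ≤ ((A3 (m - 2)).ncard : ℚ) * ((p + d - W.ncard).choose 2 : ℚ) := by exact_mod_cast hb3
      refine h3.trans (mul_le_mul_of_nonneg_right ?_ (by positivity))
      by_cases hm5 : m ≤ 5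
      · rw [if_pos hm5]
        have hm5' : m = 5 := by omega
        have hA3 : (A3 (m - 2)).ncard ≤ W.ncard.choose 3 := by
          rw [← S2.ncard_subsets_ncard_eq W hWfin 3]
          refine Set.ncard_le_ncard (fun X hX => ⟨hX.1, ?_⟩) (hWfin.finite_subsets.subset (fun X hX => hX.1))
          rw [hX.2.1, hm5']
        exact_mod_cast hA3
      · rw [if_neg hm5]
        have hm6 : 6 ≤ m := by omega
        have hN3 := S2.ncard_rank_three_subsets_mul_le M hL hplane hW (m - 2) (by omega)
        rw [show m - 2 - 2 = m - 4 by omega, show m - 2 - 3 = m - 5 by omega] at hN3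
        have hpos : (0 : ℚ) < ((m - 4 : ℕ) : ℚ) := by
          exact_mod_cast (show 0 < m - 4 by omega)
        rw [le_div_iff₀ hpos]
        exact_mod_cast hN3
    rw [← hq0]
    have hu : ({B : Set α | B ⊆ M.E ∧ B.ncard = m ∧ M.eRk B = 5 ∧ M.eRk (M.E \ B) = M.eRank}.ncard : ℚ) ≤
        (C0.ncard : ℚ) + (C1.ncard : ℚ) + (C2.ncard : ℚ) + (C3.ncard : ℚ) := by exact_mod_cast hunion
    linarith
  calc (Matroid.topCount M p 5 : ℚ)
      ≤ ((∑ m ∈ Finset.Icc 5 d,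
          {B : Set α | B ⊆ M.E ∧ B.ncard = m ∧ M.eRk B = 5 ∧ M.eRk (M.E \ B) = M.eRank}.ncard : ℕ) : ℚ) := by
        exact_mod_cast hstep1
    _ = ∑ m ∈ Finset.Icc 5 d,
          ({B : Set α | B ⊆ M.E ∧ B.ncard = m ∧ M.eRk B = 5 ∧ M.eRk (M.E \ B) = M.eRank}.ncard : ℚ) := by
        push_cast
        rfl
    _ ≤ _ := Finset.sum_le_sum hstep2

end ThmN

end PercRepro
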